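import Summits.HodgeConjecture.HodgeConjecture.Theorems.F0P6aPELInputs
import Summits.HodgeConjecture.HodgeConjecture.Theorems.F0P6aEReadings
import Summits.HodgeConjecture.HodgeConjecture.Theorems.F0P6aChartFramePin
import Literature.AlgebraicGeometry.ShimuraVarieties.UnitaryAuxiliaryTorusDatum
import Literature.NumberTheory.ComplexMultiplication.ReflexNormIdeles
import Literature.NumberTheory.ComplexMultiplication.CMTypeBasic
import Literature.NumberTheory.Automorphic.IdeleIdealClass
import Literature.NumberTheory.GaloisRepresentations.HeckeCharacterOfRayClass
import Summits.HodgeConjecture.HodgeConjecture.Theorems.F0P6aSheetTwistGeneric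
import Summits.HodgeConjecture.HodgeConjecture.Theorems.F0P6aSheetTwistFrobenius
import Summits.HodgeConjecture.HodgeConjecture.Theorems.F0P6aTwistDataOfKottRows
import Summits.HodgeConjecture.HodgeConjecture.Theorems.F0P6aCanonicalTwistIdealArithRows
import Literature.NumberTheory.NumberFields.IdealClassCoprimeRepresentative
import Literature.FieldTheory.AlgClosed.AdicCompletionAlgClosureEquivComplex
import Literature.AlgebraicGeometry.Motives.GaloisThickeningLiftAlongFieldHom
import Literature.AlgebraicGeometry.AbelianSchemes.AbelianSchemeHomDescentFlatSurjective
import Literature.AlgebraicGeometry.AbelianSchemes.AbelianSchemeDualIsogenyComp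
import Literature.AlgebraicGeometry.AbelianSchemes.SerreCoverAlongPointBaseChange
import HarnessLib
import HarnessLib.Audit.LibrarySuggestionsDenyListCruxes
import Summits.HodgeConjecture.HodgeConjecture.Theorems.F0P6aTwistTypeFrobeniusPin
import Summits.HodgeConjecture.HodgeConjecture.Theorems.F0P6aCoverEOfComplex
import Literature.AlgebraicGeometry.AbelianSchemes.SerreCoverRowsAtPointOfIsoBaseChange
import Literature.AlgebraicGeometry.Motives.GaloisThickeningLiftTwist
import Summits.HodgeConjecture.HodgeConjecture.Theorems.F0P6aStubESHEETGlobalGlue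

/-!
# `F0P6aStubESHEET` — ★ VERBATIM TWIN (K6 P∕E column wave E2, LEAD F0P6-plan «M-142a» (B); RE-HOME TABLE v1.7 (LA7-plan (g7)), canonical header «M-142a» (A), carrier «M-142d» «P-κ») of the SHEET closer `Lines/F0_P6a_StubESHEET.lean` ED. 3

**SIZE-LINT SPLIT ×3** (`Theorems/` files with proofs are ≤ 400 lines): parts `Theorems/F0P6aStubESHEETSocket.lean` → `Theorems/F0P6aStubESHEETOrgans.lean` → `Theorems/F0P6aStubESHEET.lean`, each importing the previous, cut at declaration boundaries of `Lines/F0_P6a_StubESHEET.lean`; namespaces AND sections KEPT and re-opened per part (with their `open`∕`variable` lines replayed verbatim); the options preamble is repeated. This is PART 1.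

This `Theorems/` module is the TREE BYTES of `Summits/HodgeConjecture/HodgeConjecture/Cruxes/HLiu418/Lines/F0_P6a_StubESHEET.lean` (tree sha16 f85df0dd86ddfeb6, 729 l.; sorry-free, stub-free = class B of RE-HOME TABLE v1.7)
re-homed VERBATIM with the NAMESPACE KEPT (`Summit.HodgeConjecture.HodgeConjecture.Cruxes.HLiu418.F0P6aStubESHEET`), so every fully-qualified name of its 21 declarations is UNCHANGED
(0 FQN moves, 0 downstream bytes, 0 statement bytes).  The only edits are (a) this re-headed module docstring, (b) the `Lines` imports switched to their ★ homes (l.1 `Lines.F0_P6a_PELInputs` → `Theorems.F0P6aPELInputs`; l.2 `Lines.F0_P6a_EReadings` → `Theorems.F0P6aEReadings`; l.3 `Lines.F0_P6a_ChartFramePin` → `Theorems.F0P6aChartFramePin`; l.21 `Lines.F0_P6a_CoverEOfComplex` → `Theorems.F0P6aCoverEOfComplex`),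
and (c) on the docstrings of the header-CLOSED `def … : Prop` letters (`StubESHEET`, `OrganTWIST`, `OrganSHEET`, `OrganSHEETComplex`, `OrganSHEETGlobal`) the locator tokens are spelled `(print: …)` instead of `[cite: …]` — same locators, same prose — because a `[cite:]`-tagged closed Prop in a `Theorems/` proposal is
RELOCATED to `Literature/` by the gate («STATE IT INLINE» rule; observed p852785∕p852786, LA-ref1 (g5) BOX K5 #R1), which would MOVE the FQN; these Props are statement
ABBREVIATIONS of our own sockets, not printed facts (precedent ★ `Theorems/F0P6aModuliDatumDefs.lean` `RecordModuliDatumCofinal` `(print:)` ×5).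

Why: E-column parents-first — this closer imports the P-LINE (★ K5 №5), the E-READINGS (★ E1), the frame pin (★ since K3) and the (W-L) organ module `CoverEOfComplex` (★ E2a),
and is imported by `F0_P6a_EExports` → `F0_P6a_StubGEN` → `F0_P6a_PELSpread` hub → MAIN; a `Theorems/` file cannot import a `Lines/` workfile (gate import fence).
After its LAST part is ★ the `Lines` original becomes the next edition = SHIM (`import` of this module + `HarnessLib` + carrier; 0 declarations) in a K6 shim wave on the LEAD՚s cue.
HC_CM is proved only modulo the 7 printed citations (2 remaining: hLiu418 = stmt-HodgeConjecture-24832, h413 = stmt-HodgeConjecture-24833) until rung 0 closes; a re-home is count-neutral.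

## Import provenance (header is CANONICAL: bare `import` lines, «M-142a» (A); the ROOT part carries `HarnessLib.Audit.LibrarySuggestionsDenyListCruxes`, «M-142d» «P-κ»)
- `Summits.HodgeConjecture.HodgeConjecture.Theorems.F0P6aPELInputs` — ★ K5 №5 p852908: the P-LINE twin (`Lines` module = ED. 5 shim)
- `Summits.HodgeConjecture.HodgeConjecture.Theorems.F0P6aEReadings` — ★ K6 E1 twin of `Lines/F0_P6a_EReadings.lean` ED. 2 18b1390e9a57b55f (LAST part)
- `Summits.HodgeConjecture.HodgeConjecture.Theorems.F0P6aChartFramePin` — ★ p850217 (the `Lines` module is its ED. 2 shim since K3): `IsChartOfFrame`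
- `Literature.AlgebraicGeometry.ShimuraVarieties.UnitaryAuxiliaryTorusDatum` — ★ `Aux.reflexField F Φ ι₁` (= `E♯ = ι₁(F)·E*(Φ)`), `Aux.numberField_reflexField`, `Aux.torusFinAdelic`
- `Literature.NumberTheory.ComplexMultiplication.ReflexNormIdeles` — ★ `reflexNormFiniteIdele K Φ k : (𝔸_{k,f})ˣ →* (𝔸_{K,f})ˣ` (the torus coordinate `t(sE)` of ★ (S2a) p849722∕p849972)
- `Literature.NumberTheory.ComplexMultiplication.CMTypeBasic` — ★ `CMTypeOps.flip`, `CMTypeOps.bar` (the chart՚s twist type `Φ′ = flip ι₁ (bar Φ)`, pin leaf :52)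
- `Literature.NumberTheory.Automorphic.IdeleIdealClass` — ★ `FiniteAdeleRing.toFractionalIdeal` (the ideal `[z]` of a finite idèle)
- `Literature.NumberTheory.GaloisRepresentations.HeckeCharacterOfRayClass` — ★ `modulusExp` (the congruence `z ≡ 1 mod (N)` in the shape ★ p849693 `exists_mul_unitEmbedding_integral_congr` PRODUCES)
- `Summits.HodgeConjecture.HodgeConjecture.Theorems.F0P6aSheetTwistGeneric` — ★ p850275 LEG-G `exists_sheetTwist_generic` (LA4-p05 (g4))
- `Summits.HodgeConjecture.HodgeConjecture.Theorems.F0P6aSheetTwistFrobenius` — p850297 LEG-F `exists_sheetTwist_frobenius` (LA4-p05 (g4))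
- `Summits.HodgeConjecture.HodgeConjecture.Theorems.F0P6aTwistDataOfKottRows` — ★ (S6) zip `exists_twistData_letterRows_of_kottRows` (LA7-p02 (g3))
- `Summits.HodgeConjecture.HodgeConjecture.Theorems.F0P6aCanonicalTwistIdealArithRows` — ★ p849355 `canonicalTwistIdeal_eLetterRows_sigma` (LA4-p04 (g2))
- `Literature.NumberTheory.NumberFields.IdealClassCoprimeRepresentative` — ★ `mul_pointwise_smul_sup_eq_top_of_sup_span_natCast_eq_top` (§1b glue (b′))
- `Literature.FieldTheory.AlgClosed.AdicCompletionAlgClosureEquivComplex` — ★ p849445 + ED. 2 p850285 (LA4-p01): `σ : F̄_w ≃ₐ[F] ℂ` relative to a sheet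
- `Literature.AlgebraicGeometry.Motives.GaloisThickeningLiftAlongFieldHom` — ★ p849545 + ED. 2 p850145 (LA4-p01): sheet points along a field hom
- `Literature.AlgebraicGeometry.AbelianSchemes.AbelianSchemeHomDescentFlatSurjective` — ★ `comp_eq_one_iff_of_iso_comp_eq` (kernel clause along an iso)
- `Literature.AlgebraicGeometry.AbelianSchemes.AbelianSchemeDualIsogenyComp` — ★ `DualPair.dualIsogenyOver_comp`
- `Literature.AlgebraicGeometry.AbelianSchemes.SerreCoverAlongPointBaseChange` — ★ p850295 (LA4-p01): `coverKer∕cover_readAt_comp_of_eq`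
- `HarnessLib`
- `Summits.HodgeConjecture.HodgeConjecture.Theorems.F0P6aTwistTypeFrobeniusPin` — ★ p850372 (S7-F) `idealReflexTypeNorm_valuedIn_flip_bar_eq_prod_filter_of_kottAdaptedAt` (LA4-p04 (g3))
- `Summits.HodgeConjecture.HodgeConjecture.Theorems.F0P6aCoverEOfComplex` — ★ K6 E2a twin of `Lines/F0_P6a_CoverEOfComplex.lean` (LAST part; `…CoverEOfComplexBody` rides)
- `Literature.AlgebraicGeometry.AbelianSchemes.SerreCoverRowsAtPointOfIsoBaseChange` — ★ p850783 (LA4-p01 (g3), DEAL #39): `coverKer_rows_readAt_of_iso_baseChange` (the engine of §3c′)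
- `Literature.AlgebraicGeometry.Motives.GaloisThickeningLiftTwist` — ★ p850817 (LA4-p01 (g3)): `thickeningLift_comp_algEquiv_left` (the sheet law `ℓ_{eT∘γ} = ℓ_{eT} ≫ gal γ⁻¹`)
- `Summits.HodgeConjecture.HodgeConjecture.Theorems.F0P6aStubESHEETGlobalGlue` — ED. 3: (T) ★ p851204 LEG-E(γ′) GLOBAL GLUE (LA7-p01 (g4)), Theorems currency — co-imports with the Lines closer after K3-E

## Original module docstring (verbatim)
# Crux `HLiu418` — P6 sub-line F0-P6a, (S8) THE SHEET-LINE CLOSER LEAF `Lines/F0_P6a_StubESHEET.lean` — CLOSER SKELETON v2 (HOME-first; LA4-plan (g2) pen by A-p01 (g28) «=» 06:45:14Z; v2 = v1 6943badd with ONE junction token flipped on LA4-p05 (g4)՚s FROBENIUS TEST 07:19:22Z: `z = t(sE)` in `(𝔸_{F,f})ˣ` replaces `z · t(sE) = 1`)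

Cell `hodgecm-mathlib` (D-0151), FLOOR 0, P6 «MOD programme»; crux `stmt-HodgeConjecture-24832` (hLiu418); count-neutral (`--supports` only, nothing filed by
this file).  X-leaf `Lines/F0_P6a_EExports.lean` ED. 1 (tree sha16 184468800dd36650, A-p01 (g28) WRITTEN 2026-09-02T06:35:44Z) registers the socket
`stub_ESHEET : RecordESheetReading` (:215, `sorry`).  THIS LEAF is its closer in the cell՚s standard shape (cf. L5 `StubEHECKE` closer, LA5-plan (g3)):
it does NOT import the X-leaf; §0 re-states the letter `RecordESheetReading` TOKEN FOR TOKEN as `StubESHEET` (tree :149–:210, frame-pinned through the SAME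
constant `F0P6aChartFramePin.IsChartOfFrame`), so that X-leaf ED. 2 can pay `stub_ESHEET := F0P6aStubESHEET.stub_ESHEET_of_line` by `delta`.

## The cut (LA4-plan (g2) 06:41:41Z; E-pen A-p01 (g28) «=» + ONE junction amendment 06:45:14Z)
The letter lets US choose the twist data `(𝔞_γ, n_γ)_{γ ∈ Gal(Fᵢ∕F)}`; its SEVEN arithmetic rows (a)(b)(c)(FROB-𝔞)(FROB-n)(π1)(FROB-can) and its TWO cover rows
(K-law)(cover) are coupled ONLY through «the ideal pinned at Frobenius by (FROB-can) is ALSO a sheet twist».  Hence ONE junction predicate and TWO organs: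
* §1 `twistType ι₁ Φ hΦ : CMType F := flip ι₁ (bar Φ)` — the chart՚s CM type (pin leaf: `C.J = auxComplexStructureV Fr ι₁ (flip ι₁ (bar Φ))`; = the «twist type
  `Φ_tw = {φ | mOf ι₁ Φ φ ≠ 0 ∧ φ ≠ ῑ₁}`» of ★ `F0P6aCanonicalTwistIdealAsReflexTypeNorm`), and the JUNCTION
  **`IsSheetTwistOf ι₁ τE Φ hΦ N γ 𝔞 n`**: rows (a)(b)(c) on `(𝔞, n)` ∧ `∃ (γ̃ : ℂ ≃+* ℂ)` lifting `γ` through `τE` and fixing `ι₁F`, an EXACT `E♯`-correspondent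
  `sE` of `γ̃` (★ `IsArtinCorrespondent ↥E♯ (algebraMap ↥E♯ ℂ) sE γ̃`, `E♯ = Aux.reflexField F Φ_tw ι₁`) and a finite idèle `z` of `F` with
  **`z = t(sE)`** (an equation in `(𝔸_{F,f})ˣ`; `t(sE) = reflexNormFiniteIdele F Φ_tw E♯ sE`, the torus coordinate (S2a) exports — A-p01՚s amendment: `z` is PINNED to a correspondent, no
  free `F^×`-coset, since a rational factor breaks the similitude clause while moving the correspondent inside `ker art` does not), `[z] = 𝔞⁻¹`
  (★ `FiniteAdeleRing.toFractionalIdeal`) and `z ≡ 1 mod (N)` in the local shape ★ p849693 produces (`Valued.v (z_v) = 1 ∧ Valued.v (z_v − 1) ≤ exp (−ν_v(N))`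
  at every `v ∣ N`).  The similitude clause `z z̄ ∈ 𝔸_{ℚ,f}^×` is a LEMMA of `z = t(sE)` (`t ∈ T₀`, ★ `reflexNormFiniteIdele_mem_torusFinAdelic_of_le`), not a field.  ORIENTATION (v2, LA4-p05 (g4) 07:19:22Z): the tree՚s `IsArtinCorrespondent` is Milne՚s (59) `art = rec⁻¹` (arithmetic Frobenius at `w` ↔ `(ϖ_w⁻¹)_w`, ★ `isArtinCorrespondent_uniformizerIdele_inv_iff`), so for `γ` in the Frobenius coset `[t(sE)] = g_{Φ_tw}(𝔭_w)⁻¹ = 𝔞_can⁻¹` and `z = t(sE)` gives `[z] = 𝔞_γ⁻¹` with `𝔞_γ = 𝔞_can` INTEGRAL ((FROB-can) ✓); the v1 form `z·t(sE) = 1` would force `𝔞_γ = 𝔞_can⁻¹` (refuted by `F = ℚ(√−23)`, `Fᵢ` = Hilbert class field, `[𝔭_w]` of order 3).  Sheet side: ★ p849947 `T′[x₀,b] = σ • f(σ⁻¹ • [x₀,b])` at `σL := γ̃`, ★ p849999 with `uE := sE ↔ γ̃`, marking `b(a)·ũ_V(1, z)`, `z = t(sE)` — NO inverses anywhere.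
* §2 **`OrganTWIST`** (arithmetic; hands (S6) ★ p849693∕p849712∕p849752 LA7-p02∕LA4-p05, (S7) ★ p849648∕p849355 LA4-p04): for every letter place context
  `(w, p, f)` with the KOTT guards and every datum sheet `e`, twist data with the seven rows AND `∀ γ, IsSheetTwistOf … γ (𝔞_γ) (n_γ)` — socket `stub_TWIST`.
* §3 **`OrganSHEET`** (geometric; hands (S1) ★ p849895 LA7-p01, (S2a) ★ p849704∕p849722∕p849972 LA6-p02∕LA4-p03, (S2b) ★ p849685∕p849931 LA4-p05, (S3)(S3♯)
  ★ p849897∕p849947∕p849924∕p849999 LA4-p03, (S4) junction, (S5) ★ p849445∕p849519 LA4-p01): in the letter՚s chart context, for every `(γ, 𝔞, n)` with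
  `IsSheetTwistOf … γ 𝔞 n`, the rows (K-law) `CoverKerE … (e′ ∘ γ) 𝔞 n y` and (cover) `CoverE …` at every sheet `e′` and point `y` — socket `stub_SHEET`.
* §4 HEAD **`stub_ESHEET_of_line : StubESHEET`** PROVED from the two sockets (8 lines).
Sorries at ED. 1: EXACTLY 2 {`stub_TWIST`, `stub_SHEET`}; ED. 2: EXACTLY 1 {`hole_SHEET_global`}; ED. 3: 0 — `--axioms stub_ESHEET_of_line` = TRIO (see `## Editions`).  Why the cut might fail: if (S2b)՚s marking of `A ⊗ 𝔞⁻¹`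
reads the central factor on the other CM type of the special pair (`Ψ = Φ_tw ∖ {ι₁} ∪ {ῑ₁}`), `twistType` is the ONE token to change (both organs and the head go
through it); if the level transport wants the congruence in `K_δ(N)`-unit form rather than the valuation form, §1՚s last clause is re-spelled — statements of the
organs do not move.  HC_CM is proved only modulo the 7 printed citations (2 remaining: hLiu418 = stmt-HodgeConjecture-24832, h413 = stmt-HodgeConjecture-24833)
until rung 0 closes.
[cite: Shimura1998, §13.1 Thm. 1 pp. 97–99; §18.6 Thm. 18.6 pp. 124–125, proof pp. 127–129] [cite: RapoportSmithlingZhang2020Diagonal, §3.2 p. 11, §4.3 p. 20]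
[cite: MilneCM2006, Ch. I §1 Rem. 1.25, Prop. 1.26] [cite: Milne2005ShimuraVarieties, Def. 12.8 (59)–(62) p. 114]

## Editions (ADD-ONLY over the WRITTEN ED. 1; pen LA4-plan (g2))
* ED. 1 (tree sha16 462ab2e641bb6db3, WRITTEN 2026-09-02T08:47:09Z, commit 55b5ba830a73, BUILT (JV) req450 09:18:55Z): `stub_TWIST` PAID (TRIO); sockets EXACTLY {`stub_SHEET`}.
* ED. 2 (tree sha16 d582eb4401e38ac4, WRITTEN 2026-09-02T10:09:39Z, commit c49347a4dda7, BUILT (KV) req477 10:22:28Z; ROAD OF RECORD v3 = (γ′) «SERRE TENSOR OVER X, CLASSIFIED», pen rulings 09:42:41Z∕10:01Z: §3c socket = LA7-p01 (g4)՚s `OrganSHEETGlobalCore` text, «ISO» currency): + §3b LEG-E (LA7-p01 (g3):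
  `sheetAlgHom`, `coverKerBody_of_rows_comp_iso`, `OrganSHEETComplex`, `hole_SHEET_complex`, and `stub_SHEET` PROVED from `hole_SHEET_complex` — the ONE body swap),
  + §3c `OrganSHEETGlobal` ∕ socket `hole_SHEET_global`, + §3c′ LA4-p01 (g3) Lines v3 §1 `coverKerBody_sheet_of_global_rows` BY COPY (sorry-free), `hole_SHEET_complex`
  PROVED from them; (S5) leaf `Lines/F0_P6a_CoverEOfComplex` BY IMPORT.  Sockets EXACTLY {`hole_SHEET_global`}; letter `StubESHEET`, junction `IsSheetTwistOf`,
  organs `OrganTWIST`∕`OrganSHEET`, head `stub_ESHEET_of_line` — bytes and types UNCHANGED.  ED. 3 := + LEG-E(γ′) GLOBAL GLUE `organSHEETGlobal_of_organs` (LA7-p01 (g4)) ⇒ 0 sorries.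
* ED. 3 (this file; LA4-plan (g2), after the K3-E shim flip (LG) req487 under which Lines E-defs∕pin∕E6 became shims of their `Theorems.*` twins):
  ED. 2 ⊕ `import …Theorems.F0P6aStubESHEETGlobalGlue` ⊕ `hole_SHEET_global := Summit.HodgeConjecture.HodgeConjecture.Theorems.F0P6aStubESHEETGlobalGlue.organSHEETGlobal_holds`
  ((T) ★ p851204 LA7-p01 (g4) ∕ ED. 2 ★ p851256 LA4-p01 (g4); organs B1 ★ p850896 · B2 ★ p850979∕p851047 · B3 ★ p851046 over (B3-SRC) ★ p851009 + `hpt` ★ p850898) ⇒ sockets ∅,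
  head `stub_ESHEET_of_line` SORRY-FREE and TRIO.
-/

set_option autoImplicit false

noncomputable section


/-! ## (S5) BY IMPORT — (W-L4a) leaf `Lines/F0_P6a_CoverEOfComplex.lean` ED. 1 (tree sha16 ec52ca66282759d5, WRITTEN 2026-09-02T08:58:53Z, commit 31bed5e5bb4d; ns `…F0P6aCoverEOfComplex`): `coverKerBody`, `coverKerBody_of_rows_comp_iso`-inputs, `coverKerBody_of_cover_onto_iso` etc. are now IMPORTED (pen LA4-plan (g2) v6c = LA7-p01 (g3) v6b bbadc842 minus the by-copy block :61–:472, plus the import). -/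
namespace Summit.HodgeConjecture.HodgeConjecture.Cruxes.HLiu418.F0P6aStubESHEET

set_option linter.dupNamespace false  -- `Summit.HodgeConjecture.HodgeConjecture.…` BY DESIGN (D-0017)

open CategoryTheory CategoryTheory.Limits NumberField IsDedekindDomain MulAction AlgebraicGeometry
open scoped Matrix Polynomial Pointwise nonZeroDivisors
open Literature.NumberTheory.GaloisRepresentations
open Literature.NumberTheory.Automorphic Literature.NumberTheory.Automorphic.UnitaryGroup
open Literature.AlgebraicGeometry.ShimuraVarieties Literature.AlgebraicGeometry.ShimuraVarieties.UnitaryCanonicalModel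
open Literature.NumberTheory.Automorphic.Liu2021.AppendixC
open Literature.AlgebraicGeometry.Motives (AlgPoints ComplexPoints SchemeOver thickeningLift specOver)
open Literature.AlgebraicGeometry.Motives.AbelianVariety (bcSpec)
open Literature.AlgebraicGeometry.AbelianSchemes (PolarizedAbelianSchemeWithLevel AbelianSchemeOver)
open Literature.AlgebraicGeometry.ModuliOfAbelianVarieties
open Summit.HodgeConjecture.HodgeConjecture.Cruxes.HLiu418.F0P6aPELWitnessE
open Summit.HodgeConjecture.HodgeConjecture.Cruxes.HLiu418.F0P6aStubE6 (RingActionReading)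
open Summit.HodgeConjecture.HodgeConjecture.Cruxes.HLiu418.F0P6aStubKOTT (KottAdaptedAt UnmixedAt)
open Summit.HodgeConjecture.HodgeConjecture.Cruxes.HLiu418.F0P6aEReadings (ETwistKerAt CoverKerE CoverE)
open Summit.HodgeConjecture.HodgeConjecture.Cruxes.HLiu418.F0P6aChartFramePin (IsChartOfFrame)

open Literature.AlgebraicGeometry.Motives (CMType)
open Literature.AlgebraicGeometry.ShimuraVarieties.UnitaryCanonicalModel.Aux (ratBasis torusFinAdelic reflexField numberField_reflexField)
open Literature.AlgebraicGeometry.ShimuraVarieties.UnitaryCurve Literature.AlgebraicGeometry.ShimuraVarieties.UnitaryCurve.AuxV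
open Literature.NumberTheory.ComplexMultiplication (reflexNormFiniteIdele)
open Literature.NumberTheory.ComplexMultiplication.CMTypeOps (flip bar)

/-! ### §0 The socket letter BY VALUE (X-leaf `RecordESheetReading` :149–:210 TOKEN FOR TOKEN) -/

set_option maxHeartbeats 400000 in
/-- **`StubESHEET` = the X-leaf letter `RecordESheetReading` VERBATIM** (tree `Lines/F0_P6a_EExports.lean` ED. 1 18446880 :149–:210; frame pin through the shared
constant `F0P6aChartFramePin.IsChartOfFrame`), so that `F0P6aEExports.stub_ESHEET := stub_ESHEET_of_line` elaborates by `delta` in X-leaf ED. 2.  (T-E): twist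
data with rows (a)(b)(c)(FROB-𝔞)(FROB-n)(π1)(FROB-can) and the cover rows (K-law)(cover).  A `Prop`; NOT asserted by this declaration.
(print: Shimura1998, §13.1 Thm. 1 pp. 97–99; §18.6 Thm. 18.6 pp. 124–125) (print: RapoportSmithlingZhang2020Diagonal, §3.2 p. 11, §4.3 p. 20) -/
def StubESHEET : Prop :=
  ∀ (F : Type) [Field F] [NumberField F] [IsCMField F] [IsGalois ℚ F] (ι₁ : F →+* ℂ)
    (Jstar : Matrix (Fin 2) (Fin 2) F) (hJ : (Jstar.map (IsCMField.complexConj F))ᵀ = Jstar) (hJu : IsUnit Jstar)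
    (K₀ : C5.OpenCompactSubgroup (GSAdele F Jstar)) (S : RecordSystemGS F Jstar ι₁ K₀) (_hU7ₛ : S.HeckeTranslateDefinedOver) (Kc : C5.SmallLevel K₀)
    (Fi : Type) [Field Fi] [NumberField Fi] [Algebra F Fi] [IsGalois F Fi] (τE : Fi →+* ℂ) (_hτE : τE.comp (algebraMap F Fi) = ι₁)
    (Φ : Set (F →+* ℂ)) (hΦ : IsCMTypeThrough ι₁ Φ) (C : AuxChartGS F ι₁ Jstar K₀ S Kc Fi τE Φ)
    (ξ : F) (k : ℕ) (Fr : SymplecticFrameV F (RingHom.id F) Jstar ((k : ℚ) • ξ) C.g C.δ) (_hpin : IsChartOfFrame hΦ C ξ k Fr)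
    (ε : (Literature.AlgebraicGeometry.Motives.baseChange F Fi).obj (S.M.obj Kc) ⟶
        (Literature.AlgebraicGeometry.Motives.baseChange ℚ Fi).obj C.𝓜.M)
    (_hε : letI : Algebra Fi ℂ := τE.toAlgebra
      ∀ (P : ComplexPoints ((Literature.AlgebraicGeometry.Motives.baseChange F Fi).obj (S.M.obj Kc)))
        (Pflat : letI : Algebra F ℂ := ι₁.toAlgebra; ComplexPoints (S.M.obj Kc)),
        Pflat.left = P.left ≫ pullback.fst (S.M.obj Kc).hom (bcSpec F Fi) →
        (AlgPoints.map ε P).left ≫ pullback.fst C.𝓜.M.hom (bcSpec ℚ Fi) =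
          (letI : Algebra F ℂ := ι₁.toAlgebra; (C.f (S.pts Kc Pflat)).left))
    (ρ : AbelianSchemeOver.RingAction (𝓞 F) (C.𝓜.univ.baseChange (ε.left ≫ pullback.fst C.𝓜.M.hom (bcSpec ℚ Fi))).A),
    RingActionReading C ε ρ →
    ∀ (w : HeightOneSpectrum (𝓞 F)) (_hw : (IsCMField.complexConj F) • w ≠ w),
      UnitaryGroup.IsHyperspecialAt ↥(maximalRealSubfield F) F (IsCMField.complexConj F) 2 Jstar Kc.1.1
          (w.under (𝓞 ↥(maximalRealSubfield F))) →
      (UnitaryGroup.isUnit_placeForm Jstar hJu w).unit ∈ glInt 2 (w.adicCompletion F) →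
      ∀ (pChar fDeg : ℕ), Nat.Prime pChar → (pChar : 𝓞 F) ∈ w.asIdeal →
        Nat.card (𝓞 F ⧸ ((IsCMField.complexConj F) • w).asIdeal) = pChar ^ fDeg → ¬ pChar ∣ C.N →
        KottAdaptedAt ι₁ w Φ → UnmixedAt ι₁ w Φ →
        ∀ (e : Fi →ₐ[F] AlgebraicClosure (w.adicCompletion F)),
        letI P := C.𝓜.univ.baseChange (ε.left ≫ pullback.fst C.𝓜.M.hom (bcSpec ℚ Fi))
  ∃ (twistIdeal : (Fi ≃ₐ[F] Fi) → Ideal (𝓞 F)) (twistNorm : (Fi ≃ₐ[F] Fi) → ℕ),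
    (∀ γ : Fi ≃ₐ[F] Fi, Ideal.span {((twistNorm γ : ℕ) : 𝓞 F)} = twistIdeal γ * (IsCMField.complexConj F) • twistIdeal γ) ∧
    (∀ γ : Fi ≃ₐ[F] Fi, twistIdeal γ ⊔ Ideal.span {((C.N : ℕ) : 𝓞 F)} = ⊤) ∧
    (∀ γ : Fi ≃ₐ[F] Fi, twistIdeal γ ≠ ⊥) ∧
    (∀ (σ : Field.absoluteGaloisGroup (w.adicCompletion F)), IsAbsArithFrob σ → ∀ γ : Fi ≃ₐ[F] Fi,
      ((AlgEquiv.restrictScalars F (Field.absoluteGaloisGroup.toAlgEquiv (w.adicCompletion F) σ) :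
          AlgebraicClosure (w.adicCompletion F) ≃ₐ[F] AlgebraicClosure (w.adicCompletion F)) :
          AlgebraicClosure (w.adicCompletion F) →ₐ[F] AlgebraicClosure (w.adicCompletion F)).comp e = e.comp (γ : Fi →ₐ[F] Fi) →
      w.asIdeal ∣ twistIdeal γ) ∧
    (∀ (σ : Field.absoluteGaloisGroup (w.adicCompletion F)), IsAbsArithFrob σ → ∀ γ : Fi ≃ₐ[F] Fi,
      ((AlgEquiv.restrictScalars F (Field.absoluteGaloisGroup.toAlgEquiv (w.adicCompletion F) σ) :
          AlgebraicClosure (w.adicCompletion F) ≃ₐ[F] AlgebraicClosure (w.adicCompletion F)) :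
          AlgebraicClosure (w.adicCompletion F) →ₐ[F] AlgebraicClosure (w.adicCompletion F)).comp e = e.comp (γ : Fi →ₐ[F] Fi) →
      twistNorm γ = pChar ^ fDeg) ∧
    (∀ (σ : Field.absoluteGaloisGroup (w.adicCompletion F)), IsAbsArithFrob σ → ∀ γ : Fi ≃ₐ[F] Fi,
      ((AlgEquiv.restrictScalars F (Field.absoluteGaloisGroup.toAlgEquiv (w.adicCompletion F) σ) :
          AlgebraicClosure (w.adicCompletion F) ≃ₐ[F] AlgebraicClosure (w.adicCompletion F)) :
          AlgebraicClosure (w.adicCompletion F) →ₐ[F] AlgebraicClosure (w.adicCompletion F)).comp e = e.comp (γ : Fi →ₐ[F] Fi) →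
      twistIdeal γ ⊔ (((IsCMField.complexConj F) • w).asIdeal : Ideal (𝓞 F)) = ⊤) ∧
    (∀ (σ₀ : AlgebraicClosure (w.adicCompletion F) →+* ℂ), σ₀.comp (algebraMap F (AlgebraicClosure (w.adicCompletion F))) = ι₁ →
      ∀ (τR : (F →+* AlgebraicClosure (w.adicCompletion F)) → (𝓞 F →+* ↥(closureValuationSubring (w.adicCompletion F)))),
        (∀ (τ : F →+* AlgebraicClosure (w.adicCompletion F)) (x : 𝓞 F),
          ((τR τ x : ↥(closureValuationSubring (w.adicCompletion F))) : AlgebraicClosure (w.adicCompletion F)) = τ (x : F)) →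
      ∀ (σ : Field.absoluteGaloisGroup (w.adicCompletion F)), IsAbsArithFrob σ → ∀ γ : Fi ≃ₐ[F] Fi,
        ((AlgEquiv.restrictScalars F (Field.absoluteGaloisGroup.toAlgEquiv (w.adicCompletion F) σ) :
            AlgebraicClosure (w.adicCompletion F) ≃ₐ[F] AlgebraicClosure (w.adicCompletion F)) :
            AlgebraicClosure (w.adicCompletion F) →ₐ[F] AlgebraicClosure (w.adicCompletion F)).comp e = e.comp (γ : Fi →ₐ[F] Fi) →
        twistIdeal γ = ∏ τ ∈ Finset.univ.filter (fun τ : F →+* AlgebraicClosure (w.adicCompletion F) =>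
            mOf ι₁ Φ (σ₀.comp τ) ≠ 0 ∧ RingHom.ker ((IsLocalRing.residue ↥(closureValuationSubring (w.adicCompletion F))).comp (τR τ)) ≠
              (((IsCMField.complexConj F) • w).asIdeal : Ideal (𝓞 F))),
          RingHom.ker ((IsLocalRing.residue ↥(closureValuationSubring (w.adicCompletion F))).comp (τR τ))) ∧
    (∀ (e' : Fi →ₐ[F] AlgebraicClosure (w.adicCompletion F)) (γ : Fi ≃ₐ[F] Fi)
      (y : AlgPoints (S.M.obj Kc) (AlgebraicClosure (w.adicCompletion F))),
      CoverKerE S Kc w e' P.A ρ P.D P.pol P.level (e'.comp (γ : Fi →ₐ[F] Fi)) (twistIdeal γ) (twistNorm γ) y) ∧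
    ∀ (e' : Fi →ₐ[F] AlgebraicClosure (w.adicCompletion F)) (γ : Fi ≃ₐ[F] Fi)
      (y : AlgPoints (S.M.obj Kc) (AlgebraicClosure (w.adicCompletion F))),
      CoverE S Kc w e' P.A ρ P.D P.pol P.level (e'.comp (γ : Fi →ₐ[F] Fi)) (twistIdeal γ) (twistNorm γ) y

/-! ### §1 The junction: the chart՚s twist type and `IsSheetTwistOf` -/

/-- **The chart՚s CM type `Φ_tw := flip ι₁ (bar Φ)`** — the type the frame pin puts on the chart (`C.J = auxComplexStructureV Fr ι₁ (flip ι₁ (bar Φ))`, pin leaf),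
equivalently the «twist type» `{φ | mOf ι₁ Φ φ ≠ 0 ∧ φ ≠ ῑ₁} = {ι₁} ∪ {φ̄ | φ ∈ Φ, φ ≠ ι₁}` of ★ `F0P6aCanonicalTwistIdealAsReflexTypeNorm`; its reflex compositum
`E♯ = Aux.reflexField F Φ_tw ι₁` (`= ι₁(F)` for `F∕ℚ` Galois, ★ `Aux.reflexField_le_fieldRange_of_isGalois`) carries the correspondents `sE`, and its reflex norm
`t = reflexNormFiniteIdele F Φ_tw E♯` is the torus coordinate of ★ (S2a).  THE ONE TOKEN TO CHANGE if the E-pen normalises the twist on the swapped type.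
[cite: RapoportSmithlingZhang2020Diagonal, §3.2 (3.8) p. 11] [cite: Shimura1998, §18.6 (2) p. 128] -/
def twistType {F : Type} [Field F] (ι₁ : F →+* ℂ) (Φ : Set (F →+* ℂ)) (hΦ : IsCMTypeThrough ι₁ Φ) : CMType F :=
  flip ι₁ (bar (⟨Φ, hΦ.2⟩ : CMType F))

set_option maxHeartbeats 400000 in
/-- **THE JUNCTION `IsSheetTwistOf ι₁ τE Φ hΦ N γ 𝔞 n`** («`(𝔞, n)` IS a sheet twist of `γ ∈ Gal(Fᵢ∕F)` at level `N`»): the integrality rows (a) `(n) = 𝔞𝔞̄`,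
(b) `𝔞 ⊔ (N) = ⊤`, (c) `𝔞 ≠ 0`, AND a lift `γ̃ : ℂ ≃+* ℂ` of `γ` through `τE` fixing `ι₁F` pointwise, an EXACT `E♯`-correspondent `sE` of `γ̃`
(★ `IsArtinCorrespondent`), and a finite idèle `z` of `F` with `z = t(sE)` in `(𝔸_{F,f})ˣ` (A-p01 (g28) 06:45:14Z: PINNED to a correspondent, no `F^×`-coset; orientation LA4-p05 (g4) 07:19:22Z), `[z] = 𝔞⁻¹` and `z ≡ 1 mod (N)`
(valuation form, ★ p849693՚s output shape).  Produced by (S6)∕(S7) (`OrganTWIST`), consumed by (S2b)∕(S3♯)∕(S4) (`OrganSHEET`): `ψ_𝔞[v, a] = [J v, b(a)·ũ_V(1, z)]`.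
JUNCTION FROZEN at the v2 rows (LA7-p01 (g3) LEGPLAN (M2) ∕ dealer ruling 07:43:53Z ∕ E-dealer A-p01 (g28) 07:44:27Z «=», 2026-09-02): NO row (d) `𝔞 ⊔ c𝔞 = ⊤`
(organ-internal where a leg wants it: ★ `splitPrime_typeProd_twistRows` ∕ ★ `canonicalTwistIdeal_sup_complexConj_smul_eq_top_sigma`), NO row (e) `Nat.Coprime n (∏ δᵢ)` (unpayable on the
Frobenius coset by (FROB-n); unneeded on road B′ «Serre tensor per complex fibre»); (b′) `Nat.Coprime n N` is READ OFF rows (a)(b) — glue `IsSheetTwistOf.coprime_norm_level` (§1b).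
A `Prop`; nothing asserted.  [cite: Shimura1998, §18.6 proof pp. 127–129] [cite: MilneCM2006, Ch. I §1 Rem. 1.25, Prop. 1.26] [cite: Milne2005ShimuraVarieties, Def. 12.8 (59)–(62) p. 114] -/
def IsSheetTwistOf {F : Type} [Field F] [NumberField F] [IsCMField F] (ι₁ : F →+* ℂ)
    {Fi : Type} [Field Fi] [Algebra F Fi] (τE : Fi →+* ℂ) (Φ : Set (F →+* ℂ)) (hΦ : IsCMTypeThrough ι₁ Φ) (N : ℕ)
    (γ : Fi ≃ₐ[F] Fi) (𝔞 : Ideal (𝓞 F)) (n : ℕ) : Prop :=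
  Ideal.span {((n : ℕ) : 𝓞 F)} = 𝔞 * (IsCMField.complexConj F) • 𝔞 ∧
  𝔞 ⊔ Ideal.span {((N : ℕ) : 𝓞 F)} = ⊤ ∧ 𝔞 ≠ ⊥ ∧
  haveI : NumberField ↥(reflexField F (twistType ι₁ Φ hΦ) ι₁) := numberField_reflexField F (twistType ι₁ Φ hΦ) ι₁
  ∃ (γ' : ℂ ≃+* ℂ) (sE : (FiniteAdeleRing (𝓞 ↥(reflexField F (twistType ι₁ Φ hΦ) ι₁)) ↥(reflexField F (twistType ι₁ Φ hΦ) ι₁))ˣ)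
    (z : (FiniteAdeleRing (𝓞 F) F)ˣ),
    (∀ x : Fi, γ' (τE x) = τE (γ x)) ∧ (∀ x : F, γ' (ι₁ x) = ι₁ x) ∧
    IsArtinCorrespondent ↥(reflexField F (twistType ι₁ Φ hΦ) ι₁) (algebraMap ↥(reflexField F (twistType ι₁ Φ hΦ) ι₁) ℂ) sE γ' ∧
    z = reflexNormFiniteIdele F (twistType ι₁ Φ hΦ) (reflexField F (twistType ι₁ Φ hΦ) ι₁) sE ∧
    FiniteAdeleRing.toFractionalIdeal (𝓞 F) F z = ((𝔞 : FractionalIdeal (𝓞 F)⁰ F))⁻¹ ∧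
    ∀ v : HeightOneSpectrum (𝓞 F), Ideal.span {((N : ℕ) : 𝓞 F)} ≤ v.asIdeal →
      Valued.v ((z : FiniteAdeleRing (𝓞 F) F) v) = 1 ∧
      Valued.v ((z : FiniteAdeleRing (𝓞 F) F) v - 1) ≤ WithZero.exp (-(modulusExp (Ideal.span {((N : ℕ) : 𝓞 F)}) v : ℤ))

/-! ### §1b GLUE on the junction — the two glue lemmas `natCast_eq_one_of_span_eq_top` ∕ `coprime_of_norm_row_of_level_row` are ★ in
`Theorems.F0P6aStubESHEETGlobalGlue` (imported above) and are NOT re-declared here (gate `dedup.landed`; LEAD «M-142g» (A) ∕ «M-142h» (iv): the copies stay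
hub-side in the `Lines/F0_P6a_StubESHEET.lean` shim if the pen keeps their FQNs); the one consumer below cites the ★ term by its full name. -/

/-- **`IsSheetTwistOf.coprime_norm_level`** — the LEVEL-TRANSPORT input (b′) `Nat.Coprime n N` of the X-level Serre twist, READ OFF the junction (rows (a)(b)).
[cite: MilneCM2006, Ch. I §1 Prop. 1.26 (11)] [cite: Shimura1998, §18.6 proof pp. 127–129] -/
theorem IsSheetTwistOf.coprime_norm_level {F : Type} [Field F] [NumberField F] [IsCMField F] {ι₁ : F →+* ℂ}
    {Fi : Type} [Field Fi] [Algebra F Fi] {τE : Fi →+* ℂ} {Φ : Set (F →+* ℂ)} {hΦ : IsCMTypeThrough ι₁ Φ} {N : ℕ}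
    {γ : Fi ≃ₐ[F] Fi} {𝔞 : Ideal (𝓞 F)} {n : ℕ} (h : IsSheetTwistOf ι₁ τE Φ hΦ N γ 𝔞 n) : Nat.Coprime n N :=
  Summit.HodgeConjecture.HodgeConjecture.Theorems.F0P6aStubESHEETGlobalGlue.coprime_of_norm_row_of_level_row h.1 h.2.1

/-- **`IsSheetTwistOf.norm_ne_zero`** — `n ≠ 0` from rows (a)(c) (`𝔞 ≠ ⊥`, `c𝔞 ≠ ⊥`, Dedekind domain). [folklore] -/
theorem IsSheetTwistOf.norm_ne_zero {F : Type} [Field F] [NumberField F] [IsCMField F] {ι₁ : F →+* ℂ}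
    {Fi : Type} [Field Fi] [Algebra F Fi] {τE : Fi →+* ℂ} {Φ : Set (F →+* ℂ)} {hΦ : IsCMTypeThrough ι₁ Φ} {N : ℕ}
    {γ : Fi ≃ₐ[F] Fi} {𝔞 : Ideal (𝓞 F)} {n : ℕ} (h : IsSheetTwistOf ι₁ τE Φ hΦ N γ 𝔞 n) : n ≠ 0 := by
  intro hn
  have h0 : 𝔞 * (IsCMField.complexConj F) • 𝔞 ≠ ⊥ :=
    mul_ne_zero h.2.2.1 (Literature.NumberTheory.NumberFields.pointwise_smul_ne_bot (IsCMField.complexConj F) h.2.2.1)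
  apply h0
  rw [← h.1, hn, Nat.cast_zero, Ideal.span_singleton_eq_bot]

end Summit.HodgeConjecture.HodgeConjecture.Cruxes.HLiu418.F0P6aStubESHEET
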